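import Literature.NumberTheory.EllipticCurves.CastellaGrossiLeeSkinner2022.AnticyclotomicControl
import HarnessLib

/-!
# Castella–Grossi–Lee–Skinner 2022, Thm. 5.1.1 AS PROVED: the anticyclotomic control theorem under
# `E(K)[p] = 0` (the hypothesis its printed proof uses — Jetchev–Skinner–Wan 2017 Thm. 3.3.1 +
# (3.5.d) with the `G_K`-irreducibility of `E[p]` replaced by `E(K)[p] = 0`), a named fact ON THE
# LITERATURE OBJECT `X_ac`

HONEST FRAMING (cell `bsd-eis`, home `run/shared/lean/pub/bsd-eis/`; FULL-BSD rank-≤1 programme,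
row A1 = class X1 ∩ {`r_an = 1`, parity type A}: good anomalous Eisenstein prime `p > 2`). This file
vendors ONE published statement as a named fact (`def … : Prop`, nothing asserted) and proves its
bookkeeping consumers, exactly as its sibling `AnticyclotomicControl.lean` (registry A170,
`thm511_anticyclotomicControl`) does. Seat `bsd-eis-ky` (prover, Keller–Yin verification), gen 3;
memo `HOME/bsd-eis-ky-MEMO-1.md` §2 link L10 and §4 (audit U1–U9, referee PASS
`HOME/REF-VERDICT-ky-MEMO-1.md` §5).

## What and why

The sibling fact A170 transcribes the STATEMENT of CGLS Thm. 5.1.1 in its final (journal = arXiv v2)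
form, whose first hypothesis is `E(ℚ_p)[p] = 0`. At an ANOMALOUS Eisenstein prime (`a_p ≡ 1 (mod p)`)
that hypothesis may fail for every member of the isogeny class that the anticyclotomic argument
needs: Keller–Yin's "good lattice" `E'` (the member whose `E'[p]` is the non-split extension with
`p`-RAMIFIED rational line, so that `E'(K)[p] = 0`) has `E'(ℚ_p)[p] ≠ 0` exactly when the local
extension `0 → 𝔽_p(ω) → E'[p]|_{G_{ℚ_p}} → 𝔽_p → 0` splits (Serre–Tate parameter `≡ 1 (mod p²)`;
memo §3 A7, "Case II"). What the printed PROOF of Thm. 5.1.1 establishes is the theorem under the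
weaker hypothesis `E(K)[p] = 0` — verbatim (arXiv v2 TeX L2426–L2429): "This follows from the
combination of Theorem 3.3.1 and equation (3.5.d) in [JSW], noting that the arguments in the proof
of those results apply without change with the `G_K`-irreducibility of `E[p]` assumed in loc. cit.
replaced by the weaker hypothesis that `E(K)[p] = 0`, which is implied by the hypothesis
`E(ℚ_p)[p] = 0` since `p` splits in `K`". CORRECTION OF RECORD (ARM P D-AUDIT-r09, sheet
`AUDIT-CGLS22-r09-dd9871aa`, 2026-08-26; this docstring previously said that arXiv v1 "STATES Thm. 5.1.1
with first bullet `E(K)[p] = 0`" — a MISQUOTATION): arXiv v1 states the first bullet as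
"`E(K)[p]=0` and `E(ℚ_p)[p]=0`" [corpus: paper:arxiv-2008.02571 p0024:L21] (LaTeXML "Theorem 47"), with
the proof sentence [p0024:L44] ending at "… replaced by the weaker hypothesis that `E(K)[p]=0`."; v2 =
the journal keeps `E(ℚ_p)[p] = 0` as the sole first bullet (TeX L2407; the v1 words survive commented out
at L2406). NEITHER printed version states Thm. 5.1.1 under `E(K)[p] = 0` alone: the printed proof
sentence substitutes `E(K)[p] = 0` for Jetchev–Skinner–Wan's (irred_K) but does not say that print's
own local bullet `E(ℚ_p)[p] = 0` can be dropped. Hence this file transcribes a READING of the printed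
proof (the `H⁰`-cancellation argument below), whose domain is WIDER than every printed statement exactly
on `{E(K)[p] = 0 ∧ E(ℚ_p)[p] ≠ 0}` — at a good `p > 2` split in `K` that is the ANOMALOUS line
`a_p ≡ 1 (mod p)` (class X1), where the reading is load-bearing (Keller–Yin good lattice, Case II).
STATUS OF RECORD: D-AUDIT-r09 §A2 grades this decl GAPPED on that locus (everything else VERBATIM) and
types the delta as REFEREE TARGET T1 («CGLS Thm 5.1.1's conclusion under `E(K)[p] = 0 ∧ E(ℚ_p)[p] ≠ 0`»,
source to referee-read: JSW 2017 §3.3–3.5), reading flag `CGLS22-Thm511-EQp-dropped` on the X1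
consumers only; no statement in this file is changed by this correction. Its displayed formula is the one of A170 (no `#H⁰(K_v, E[p^∞])` term): Jetchev–
Skinner–Wan's Thm. 3.3.1 carries `C^Σ(W) ⊇ #H⁰(K_v,W)·#H⁰(K_v̄,W)` and their (3.5.c)–(3.5.d) carry
`#H⁰(K_v,W)⁻¹` inside `#δ_v`, squared; with `K_v = K_v̄ = ℚ_p` the two CANCEL identically, whether
or not `E(ℚ_p)[p] = 0` (memo §4 U7–U8, checked line by line on the store text of JSW pp. 11–16 and
re-checked by the cell's referee; the tree's transcription of JSW Thm. 3.3.1 itself,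
`JetchevSkinnerWan2017.thm331_anticyclotomicControl`, prints the same `H⁰`-free display at
anomalous — irreducible — primes). Every use of (irred_K) in JSW §§3.2–3.5 is through
"`H¹(K^S/K,T)_tors = 0` / `Ш¹_S(K,T)` torsion-free / `ker(h) = H⁰(K,W) = 0`", i.e. through
`E(K)[p] = 0` (memo §4 U1, U2, U5), and through `W* ≅ T^τ`, which holds for `T = T_pE` by the Weil
pairing without (irred_K) (JSW Remark after Prop. 3.2.1, "(b)"; memo U7).

So this is a CITATION of a refereed proof sentence (plus the refereed source theorem it invokes),
not a new claim; the reading steps are the two cancellations just named. It is the control link L10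
of the cell's THEOREM A (memo §2): with it, Keller–Yin's Appendix B (the torsion-allowing control
theorem, PREPRINT) is NOT needed on row A1.

## Citation header

* F. Castella, G. Grossi, J. Lee, C. Skinner, *On the anticyclotomic Iwasawa theory of rational
  elliptic curves at Eisenstein primes*, Invent. Math. **227** (2022) 517–580 = arXiv:2008.02571v2
  (final), Thm. 5.1.1 (TeX label `controlthm`, L2403–L2424) AND ITS PROOF (L2426–L2429); arXiv v1,
  Thm. 5.1.1 (LaTeXML "Theorem 47", first bullet "`E(K)[p]=0` and `E(ℚ_p)[p]=0`", p0024:L21; proof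
  sentence p0024:L44). REFEREED / PUBLISHED. Bib key
  `CastellaGrossiLeeSkinner2022`.
* D. Jetchev, C. Skinner, X. Wan, *The Birch and Swinnerton-Dyer formula for elliptic curves of
  analytic rank one*, Camb. J. Math. **5** (2017) 369–434 = arXiv:1512.06894, Thm. 3.3.1,
  Prop. 3.2.1 with Remark (b), Prop. 3.3.2, Lemma 3.3.3, §3.3.4, §3.5 (3.5.a)–(3.5.d). REFEREED /
  PUBLISHED. Bib key `JetchevSkinnerWan2017`.
* Setting, objects and dictionary: VERBATIM those of `thm511_anticyclotomicControl` (module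
  docstring of `AnticyclotomicControl.lean`): `W` globally minimal, `2 < p`, `GoodOrd W p`; `K`
  imaginary quadratic with `p` split and every `ℓ ∣ N` split; `ι : K →+* ℚ_p` inducing `v`,
  `vbar ∋ p` the other prime; `κ` anticyclotomic with topological generator `γ`;
  `𝔛_E = AcSelmer.XAc (W.baseChange K) p κ vbar ∅ γ` (strict at `v̄`, relaxed at `v`;
  `K_∞`-formulation); `log_{ω_E}` read as `padicLogOrd W p ι P`; `∏_{w∣N} c_w(E/K)_p` read as the
  tree's Tamagawa product of `E/K`. The ONLY change: the binder
  `∀ Q : E(ℚ_p), p • Q = 0 → Q = 0` of A170 is replaced by `∀ Q : E(K), p • Q = 0 → Q = 0`.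

## Contents

* `thm511_anticyclotomicControl_of_torsionFree` — the named fact (ONE new `def … : Prop`).
* PROVED: `hasCharValuationAt_of_thm511_torsionFree` (packaged currency
  `AcSelmer.XAc.HasCharValuationAt … n ∧ n = …`, literally the body shape of A170's consumer
  `hasCharValuationAt_of_thm511`), `thm511_torsionFree_padicVal_eq_of_generator` (every generator
  has the printed valuation), `thm511_torsionFree_logOrd_sub_index_eq` (the point `P` is arbitrary:
  two non-torsion points give the same `ord_p log P − ord_p [E(K):ℤP]`).

## References
* [CastellaGrossiLeeSkinner2022] Invent. Math. 227 (2022) = arXiv:2008.02571v2: Thm. 5.1.1 and its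
  proof (L2403–L2429); arXiv v1 Thm. 5.1.1.
* [JetchevSkinnerWan2017] Camb. J. Math. 5 (2017): Thm. 3.3.1, §3.5 (3.5.d), Prop. 3.2.1 Rem. (b).
* [KellerYin2024] arXiv:2402.12781v2, App. B Thm. B.0.2 (the torsion-allowing control theorem — NOT
  used; this fact replaces it on the good lattice) and §4.2 proof of Thm. 4.2.1.
* HOME/bsd-eis-ky-MEMO-1.md §2 (L10), §4 (U1–U9); HOME/REF-VERDICT-ky-MEMO-1.md §2, §5.
-/

set_option autoImplicit false

noncomputable section

open scoped Classical

open WeierstrassCurve NumberField IsDedekindDomain Field Literature.NumberTheory.EllipticCurves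
  Literature.NumberTheory.EllipticCurves.Rank1Residual
  Literature.NumberTheory.EllipticCurves.Castella2018

namespace Literature.NumberTheory.EllipticCurves.CastellaGrossiLeeSkinner2022

/-- **Castella–Grossi–Lee–Skinner, Invent. Math. 227 (2022) = arXiv:2008.02571v2 (final),
Theorem 5.1.1 (anticyclotomic control theorem, §5.1.1) AS PROVED THERE, i.e. under `E(K)[p] = 0`.**
Statement (v2, verbatim): "Assume that • `E(ℚ_p)[p] = 0`, • `rank_ℤ E(K) = 1`, • `#Ш(E/K)[p^∞] < ∞`.
Then `𝔛_E` is a torsion `Λ`-module, and letting `𝓕_E ∈ Λ` be a generator of `char_Λ(𝔛_E)`, we have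
`#ℤ_p/𝓕_E(0) = #Ш(E/K)[p^∞] · ( #(ℤ_p/((1−a_p+p)/p)·log_{ω_E} P) / [E(K):ℤ·P]_p )² · ∏_{w∣N} c_w(E/K)_p`,
where `P ∈ E(K)` is any point of infinite order". Proof (v2, verbatim, L2426–L2429): "This follows
from the combination of Theorem 3.3.1 and equation (3.5.d) in [JSW], noting that the arguments in
the proof of those results apply without change with the `G_K`-irreducibility of `E[p]` assumed in
loc. cit. replaced by the weaker hypothesis that `E(K)[p] = 0`, which is implied by the hypothesis
`E(ℚ_p)[p] = 0` since `p` splits in `K`." (arXiv v1 states the first bullet as "`E(K)[p]=0` and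
`E(ℚ_p)[p]=0`" [corpus: paper:arxiv-2008.02571 p0024:L21] — BOTH conditions; neither version prints
Thm. 5.1.1 under `E(K)[p] = 0` alone, see the module docstring's CORRECTION OF RECORD: this decl is a
READING of the proof sentence, wider than print exactly on the anomalous line `E(K)[p] = 0 ∧
E(ℚ_p)[p] ≠ 0`; ARM P D-AUDIT-r09 §A2: GAPPED there, REFEREE TARGET T1, flag
`CGLS22-Thm511-EQp-dropped`.) TRANSCRIBED with the dictionary of `thm511_anticyclotomicControl` (A170) VERBATIM —
`W` globally minimal, `2 < p`, `GoodOrd W p`; `K` imaginary quadratic, `p` split, every `ℓ ∣ N`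
split; `ι : K →+* ℚ_p` inducing `v`, `vbar ∋ p`, `vbar ≠ v`; `κ` anticyclotomic with topological
generator `γ`; `𝔛_E = AcSelmer.XAc (W.baseChange K) p κ vbar ∅ γ`; conclusion: torsion,
`char = (𝓕)`, `𝓕(0) ≠ 0`, `ord_p 𝓕(0) = ord_p #Ш(E/K)[p^∞] + 2·((ord_p(1−a_p+p) − 1 +
ord_p log_{ω_E} P) − ord_p[E(K):ℤP]) + ord_p ∏_w c_w(E/K)` — EXCEPT that the first bullet is the
proof's `E(K)[p] = 0`: `∀ Q : E(K), p • Q = 0 → Q = 0`. Reading notes (module docstring): the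
`#H⁰(K_v, E[p^∞])·#H⁰(K_v̄, E[p^∞])` of JSW Thm. 3.3.1 cancels against the `#H⁰(K_v, E[p^∞])⁻²` of
(3.5.c)–(3.5.d) (`K_v = K_v̄ = ℚ_p`), so the display is `H⁰`-free with or without `E(ℚ_p)[p] = 0`;
(irred_K) enters JSW §§3.2–3.5 only through `E(K)[p] = 0` and `W* ≅ T^τ` (Weil pairing). SOURCE =
a refereed proof sentence + its refereed source theorem, READ beyond the printed statement on the
anomalous line (flag `CGLS22-Thm511-EQp-dropped`; REFEREE TARGET T1 of ARM P D-AUDIT-r09). Role: control link L10 of the cell's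
Theorem A at an anomalous Eisenstein prime, on Keller–Yin's good lattice (`E'(K)[p] = 0`, possibly
`E'(ℚ_p)[p] ≠ 0`), replacing Keller–Yin's preprint Appendix B.
[cite: CastellaGrossiLeeSkinner2022, Thm. 5.1.1 and its proof (§5.1.1; arXiv v2 TeX L2403–L2429; arXiv v1 LaTeXML Thm. 47 p0024:L19–L44, first bullet «E(K)[p]=0 and E(ℚ_p)[p]=0»); READING on {E(K)[p]=0 ∧ E(ℚ_p)[p]≠0}, flag CGLS22-Thm511-EQp-dropped]
[cite: JetchevSkinnerWan2017, Thm. 3.3.1 with §3.5 (3.5.d), Prop. 3.2.1 Remark (b), Prop. 3.3.2, Lemma 3.3.3, §3.3.4] -/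
def thm511_anticyclotomicControl_of_torsionFree : Prop :=
  ∀ (W : WeierstrassCurve ℚ) [W.IsElliptic] [W.IsGloballyMinimal] (p : ℕ) [Fact p.Prime],
    2 < p → GoodOrd W p →
    ∀ (K : Type) [Field K] [NumberField K], IsImaginaryQuadratic K →
      SatisfiesHeegnerHypothesis p K → SatisfiesHeegnerHypothesis (W.conductorNorm ℤ) K →
    ∀ (ι : K →+* ℚ_[p]) (v vbar : HeightOneSpectrum (𝓞 K)),
      (∀ x : 𝓞 K, x ∈ v.asIdeal ↔ ‖ι (x : K)‖ < 1) →
      ((p : ℕ) : 𝓞 K) ∈ vbar.asIdeal → vbar ≠ v →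
    ∀ (κ : ZpExtension K p), κ.IsAnticyclotomic →
    ∀ (γ : absoluteGaloisGroup K) [Fact (κ.IsTopGenerator γ)],
      (∀ Q : (W.baseChange K).toAffine.Point, p • Q = 0 → Q = 0) →
      (W.baseChange K).mordellWeilRank = 1 →
      Finite (AddCommGroup.primaryComponent (W.baseChange K).sha p) →
    ∀ (P : (W.baseChange K).toAffine.Point), ¬ IsOfFinAddOrder P →
      Module.IsTorsion (IwasawaAlgebra p) (AcSelmer.XAc (W.baseChange K) p κ vbar ∅ γ) ∧
      ∃ F : IwasawaAlgebra p,
        AcSelmer.XAc.charIdeal (W.baseChange K) p κ vbar ∅ γ = Ideal.span {F} ∧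
        PowerSeries.constantCoeff F ≠ 0 ∧
        ((PowerSeries.constantCoeff F).valuation : ℤ) =
          (padicValNat p (Nat.card (AddCommGroup.primaryComponent (W.baseChange K).sha p)) : ℤ) +
            2 * (((padicValInt p (1 - W.frobeniusTrace p + p) : ℤ) - 1 + padicLogOrd W p ι P) -
              (padicValNat p (AddSubgroup.zmultiples P).index : ℤ)) +
            (padicValNat p (W.baseChange K).tamagawaProduct : ℤ)

variable {W : WeierstrassCurve ℚ} [W.IsElliptic] [W.IsGloballyMinimal] {p : ℕ} [Fact p.Prime]

/-! ### Bookkeeping consumers -/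

/-- **Thm. 5.1.1 (as proved) in the packaged currency** `AcSelmer.XAc.HasCharValuationAt … n`
("`𝔛_E` is `Λ`-torsion with a generator `𝓕`, `𝓕(0) ≠ 0`, `ord_p 𝓕(0) = n`") `∧ n =` the printed
right-hand side — literally the body shape of `hasCharValuationAt_of_thm511` (A170's consumer),
under `E(K)[p] = 0` instead of `E(ℚ_p)[p] = 0`.
[cite: CastellaGrossiLeeSkinner2022, Thm. 5.1.1 and its proof] [cite: JetchevSkinnerWan2017, Thm. 3.3.1 with (3.5.d)] -/
theorem hasCharValuationAt_of_thm511_torsionFree (h : thm511_anticyclotomicControl_of_torsionFree)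
    (hp : 2 < p) (hord : GoodOrd W p) (K : Type) [Field K] [NumberField K]
    (hK : IsImaginaryQuadratic K) (hHp : SatisfiesHeegnerHypothesis p K)
    (hHN : SatisfiesHeegnerHypothesis (W.conductorNorm ℤ) K)
    (ι : K →+* ℚ_[p]) (v vbar : HeightOneSpectrum (𝓞 K))
    (hv : ∀ x : 𝓞 K, x ∈ v.asIdeal ↔ ‖ι (x : K)‖ < 1)
    (hvbar : ((p : ℕ) : 𝓞 K) ∈ vbar.asIdeal) (hne : vbar ≠ v)
    (κ : ZpExtension K p) (hκ : κ.IsAnticyclotomic)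
    (γ : absoluteGaloisGroup K) [Fact (κ.IsTopGenerator γ)]
    (hEK : ∀ Q : (W.baseChange K).toAffine.Point, p • Q = 0 → Q = 0)
    (hrk : (W.baseChange K).mordellWeilRank = 1)
    (hfin : Finite (AddCommGroup.primaryComponent (W.baseChange K).sha p))
    (P : (W.baseChange K).toAffine.Point) (hP : ¬ IsOfFinAddOrder P) :
    ∃ n : ℕ, AcSelmer.XAc.HasCharValuationAt (W.baseChange K) p κ vbar ∅ γ n ∧
      (n : ℤ) = (padicValNat p (Nat.card (AddCommGroup.primaryComponent (W.baseChange K).sha p)) : ℤ) +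
        2 * (((padicValInt p (1 - W.frobeniusTrace p + p) : ℤ) - 1 + padicLogOrd W p ι P) -
          (padicValNat p (AddSubgroup.zmultiples P).index : ℤ)) +
        (padicValNat p (W.baseChange K).tamagawaProduct : ℤ) := by
  obtain ⟨htors, F, hF, hF0, hval⟩ :=
    h W p hp hord K hK hHp hHN ι v vbar hv hvbar hne κ hκ γ hEK hrk hfin P hP
  exact ⟨(PowerSeries.constantCoeff F).valuation,
    AcSelmer.XAc.hasCharValuationAt_of_eq htors hF hF0 rfl, hval⟩

/-- **Every generator has the printed valuation** (under `E(K)[p] = 0`): granted the fact, if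
`char_Λ(𝔛_E) = (𝓖)` for ANY `𝓖 ∈ Λ`, then `𝓖(0) ≠ 0` and `ord_p 𝓖(0)` equals the printed right-hand
side (two generators differ by a unit of `Λ`, whose constant term is a unit of `ℤ_p` —
`AcSelmer.valuation_constantCoeff_eq_of_span_singleton_eq`).
[cite: CastellaGrossiLeeSkinner2022, Thm. 5.1.1 and its proof] -/
theorem thm511_torsionFree_padicVal_eq_of_generator (h : thm511_anticyclotomicControl_of_torsionFree)
    (hp : 2 < p) (hord : GoodOrd W p) (K : Type) [Field K] [NumberField K]
    (hK : IsImaginaryQuadratic K) (hHp : SatisfiesHeegnerHypothesis p K)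
    (hHN : SatisfiesHeegnerHypothesis (W.conductorNorm ℤ) K)
    (ι : K →+* ℚ_[p]) (v vbar : HeightOneSpectrum (𝓞 K))
    (hv : ∀ x : 𝓞 K, x ∈ v.asIdeal ↔ ‖ι (x : K)‖ < 1)
    (hvbar : ((p : ℕ) : 𝓞 K) ∈ vbar.asIdeal) (hne : vbar ≠ v)
    (κ : ZpExtension K p) (hκ : κ.IsAnticyclotomic)
    (γ : absoluteGaloisGroup K) [Fact (κ.IsTopGenerator γ)]
    (hEK : ∀ Q : (W.baseChange K).toAffine.Point, p • Q = 0 → Q = 0)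
    (hrk : (W.baseChange K).mordellWeilRank = 1)
    (hfin : Finite (AddCommGroup.primaryComponent (W.baseChange K).sha p))
    (P : (W.baseChange K).toAffine.Point) (hP : ¬ IsOfFinAddOrder P)
    (G : IwasawaAlgebra p) (hG : AcSelmer.XAc.charIdeal (W.baseChange K) p κ vbar ∅ γ = Ideal.span {G}) :
    PowerSeries.constantCoeff G ≠ 0 ∧
      ((PowerSeries.constantCoeff G).valuation : ℤ) =
        (padicValNat p (Nat.card (AddCommGroup.primaryComponent (W.baseChange K).sha p)) : ℤ) +
          2 * (((padicValInt p (1 - W.frobeniusTrace p + p) : ℤ) - 1 + padicLogOrd W p ι P) -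
            (padicValNat p (AddSubgroup.zmultiples P).index : ℤ)) +
          (padicValNat p (W.baseChange K).tamagawaProduct : ℤ) := by
  obtain ⟨-, F, hF, hF0, hval⟩ :=
    h W p hp hord K hK hHp hHN ι v vbar hv hvbar hne κ hκ γ hEK hrk hfin P hP
  obtain ⟨hG0, hGF⟩ := AcSelmer.valuation_constantCoeff_eq_of_span_singleton_eq (hF.symm.trans hG) hF0
  exact ⟨hG0, by rw [hGF]; exact hval⟩

/-- **Internal consistency: the point `P` is arbitrary** (under `E(K)[p] = 0`). Granted the fact,
two points `P, P'` of infinite order give the same `ord_p log_{ω_E} P − ord_p[E(K):ℤP]` (both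
instances describe the one number `ord_p 𝓕_E(0)`, `AcSelmer.XAc.HasCharValuationAt.unique`).
[cite: CastellaGrossiLeeSkinner2022, Thm. 5.1.1 ("`P ∈ E(K)` is any point of infinite order")] -/
theorem thm511_torsionFree_logOrd_sub_index_eq (h : thm511_anticyclotomicControl_of_torsionFree)
    (hp : 2 < p) (hord : GoodOrd W p) (K : Type) [Field K] [NumberField K]
    (hK : IsImaginaryQuadratic K) (hHp : SatisfiesHeegnerHypothesis p K)
    (hHN : SatisfiesHeegnerHypothesis (W.conductorNorm ℤ) K)
    (ι : K →+* ℚ_[p]) (v vbar : HeightOneSpectrum (𝓞 K))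
    (hv : ∀ x : 𝓞 K, x ∈ v.asIdeal ↔ ‖ι (x : K)‖ < 1)
    (hvbar : ((p : ℕ) : 𝓞 K) ∈ vbar.asIdeal) (hne : vbar ≠ v)
    (κ : ZpExtension K p) (hκ : κ.IsAnticyclotomic)
    (γ : absoluteGaloisGroup K) [Fact (κ.IsTopGenerator γ)]
    (hEK : ∀ Q : (W.baseChange K).toAffine.Point, p • Q = 0 → Q = 0)
    (hrk : (W.baseChange K).mordellWeilRank = 1)
    (hfin : Finite (AddCommGroup.primaryComponent (W.baseChange K).sha p))
    (P P' : (W.baseChange K).toAffine.Point) (hP : ¬ IsOfFinAddOrder P) (hP' : ¬ IsOfFinAddOrder P') :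
    padicLogOrd W p ι P - (padicValNat p (AddSubgroup.zmultiples P).index : ℤ) =
      padicLogOrd W p ι P' - (padicValNat p (AddSubgroup.zmultiples P').index : ℤ) := by
  obtain ⟨n, hn, hne1⟩ := hasCharValuationAt_of_thm511_torsionFree h hp hord K hK hHp hHN ι v vbar hv
    hvbar hne κ hκ γ hEK hrk hfin P hP
  obtain ⟨n', hn', hne2⟩ := hasCharValuationAt_of_thm511_torsionFree h hp hord K hK hHp hHN ι v vbar
    hv hvbar hne κ hκ γ hEK hrk hfin P' hP'
  obtain rfl : n = n' := hn.unique hn'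
  omega

end Literature.NumberTheory.EllipticCurves.CastellaGrossiLeeSkinner2022

end
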